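import Literature.Probability.RandomPlanarGeometry.HexSAWSurfaceHookRenewal
import Literature.Probability.RandomPlanarGeometry.HexSAWSurfaceSqrtStrict
import HarnessLib

/-!
# Honeycomb SAW at the Duminil-Copin–Smirnov surface (brick-wall frame): the TWO-seed renewal inequality and the THIRD-order term of the
# adsorbed-phase free energy from below — `β(y)² ≥ y + y²/β(y)⁶ + y²/β(y)⁸`, hence `liminf_{y→∞} y² (β(y)² − y − 1/y) ≥ 1`

Topic `Literature/Probability/RandomPlanarGeometry` (lane «pcv-sawmu», car «WALL-THIRD-ORDER-LOWER», a-p6 g15).  Continues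
`HexSAWSurfaceHookRenewal.lean` (a-idea-1 car 27: one-visit SEEDS `seeds m`, `wbrN m 1`, the junction concatenation `jcat`,
`jcat_apply_self_one`, `jcat_seed_apply_one`, `apply_ne_zero_of_visits_eq_one`, the ONE-seed recursion `WB_seed_rec :
y B^w_{n+m} + h_m y² B^w_n ≤ B^w_{n+m+2}` and the subsolution principle) and `HexSAWSurfaceSqrtStrict.lean` (the explicit dip `Six.dw`).
Companion of the same seat's «WALL-SECOND-ORDER-SHARP» (`β(y)² = y + 1/y + O(y⁻²)`) and «WALL-THIRD-ORDER-UPPER»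
(`β(y)² ≤ y + 1/y + 1/y² + 3¹¹/y³`); this module is independent of both (CLASS S on car 27).

Sources.  E. J. Janse van Rensburg, *The Statistical Mechanics of Interacting Walks, Polygons, Animals and Vesicles* (OUP 2000), §3.1.1
(Assumptions 3.1(3), eqn (3.1): concatenation / supermultiplicativity) and §3.3.2, Lemma 3.20 (excursions).  J. M. Hammersley, G. M. Torrie,
S. G. Whittington, J. Phys. A 15 (1982) 539, §2 (concatenation of surface bridges; locator provisional, source not held).  N. Madras, G. Slade,
*The Self-Avoiding Walk* (1993), §1.2 ((1.2.15)–(1.2.17)).  BBdGDCG, CMP 326 (2014) = arXiv:1109.0358v5, §3.1, Proposition 5 (p. 9).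
I. G. Enting, I. Jensen, LNP 775 (2009), §7.4.2, Fig. 7.10 (brickwork form).

## What is proved (namespace `…SAW.HexBW.Wall`)

* §1 `jcat_junction_end_one` (the junction END of `jcat n ω υ`, time `n+2`, is on the row), `jcat_seed_apply_one_at` (inside a one-visit
  seed, at every positive even seed time, the concatenation is OFF the row — car 27's `jcat_seed_apply_one` at a general time).
* §2 ★★ **`wbrN_two_seed_le (2 < m) (0 < d) : wbrN (n+m+d) (a+1) + wbrN n a · wbrN (m+d) 1 + wbrN (n+d) a · wbrN m 1 ≤ wbrN (n+m+d+2) (a+2)`**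
  — THREE pairwise-disjoint injections (junction alone; junction + seed of length `m+d`; junction + seed of length `m` after a bridge longer by
  `d`): U vs H at time `n+m+d` (row vs inside a seed), H₁ vs H₂ at time `n+d+2` (inside the long seed at seed time `d`, even, vs the short
  construction's junction end on the row).
* §3 ★★ **`WB_two_seed_rec : y B^w_{n+m+d} + h_{m+d} y² B^w_n + h_m y² B^w_{n+d} ≤ B^w_{n+m+d+2}`** (weighted form).
* §4 ★ `le_sq_wallRate_of_two_seed_subsolution` (`x⁵ ≤ y x⁴ + h₆ y² x + h₈ y² ⇒ x ≤ β²`), ★★ `two_seed_le_wallRate_pow_ten :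
  y β⁸ + h₆ y² β² + h₈ y² ≤ β¹⁰`, `add_two_seed_div_le_sq_wallRate : β² ≥ y + h₆ y²/β⁶ + h₈ y²/β⁸`.
* §5 `Eight.fw` — the flat excursion `(0,0)(1,0)(1,−1)(2,−1)(3,−1)(4,−1)(5,−1)(5,0)(6,0)` as an explicit wall bridge of length eight with one
  visit (`Eight.f_facts`, `Eight.fw_components`, `Eight.visits_fw` by `decide`); `one_le_wbrN_eight_one : 1 ≤ wbrN 8 1`,
  `one_le_wbrN_six_one : 1 ≤ wbrN 6 1` (via `Six.dw`) — lengths kept symbolic.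
* §6 ★★ `add_div_add_div_le_sq_wallRate : y + y²/β⁶ + y²/β⁸ ≤ β²` (every `y > 0`), ★★★ **`third_window_lower (0 < y) (0 ≤ C)
  (β² ≤ y + C/y) : y + 1/y + 1/y² − 3C/y³ − 4C/y⁴ ≤ β(y)²`** — with any of the lane's upper windows (`C = 8749`, every `y ≥ 1`,
  «WALL-SECOND-ORDER-SHARP»; `C = 6`, `y ≥ 25`, a-p5 HALFPOT) this gives `liminf_{y→∞} y² (β(y)² − y − 1/y) ≥ 1`; together with
  «WALL-THIRD-ORDER-UPPER» (`≤ 1`): the THIRD coefficient is exactly ONE (assembled there).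

HONEST LABEL (author's proposal).  §1–§3: LANE LEMMAS S — the two-seed (three-image) extension of car 27's free renewal inequality is
the new device (car 27's header anticipated «FREE interleaving» of seeds with wall steps; two seed LENGTHS at once need the extra
disjointness at the junction end).  §4–§6: LANE THEOREM S; the `1/y²` coefficient `≥ 1` (given an `O(1/y)` upper window) is NEW IN WRITING
(modest) in the same sense as the companions (print: first order only, BBdGDCG p. 10).  NOT CLAIMED: values of `h₆`, `h₈` beyond `≥ 1`
(`h₆ = 1` is the companion's `wbrN_six_one`; `h₈ = 1` is not needed); the `O(y⁻³)` coefficient; anything for the armchair wall.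
-/

noncomputable section

open Finset Filter Function
open Literature.Probability.LatticeModels Literature.Probability.Percolation SimpleGraph
open _root_.Topology

namespace Literature.Probability.RandomPlanarGeometry.SAW.HexBW.Wall

variable {y : ℝ} {n m : ℕ} {ω : ℕ → Site 2}

/-! ### §1  Positions inside a junction concatenation -/

/-- The END of the junction of `jcat n ω υ` (time `n+2`) is on the row. [cite: HammersleyTorrieWhittington1982, §2 (concatenation of surface bridges)] -/
theorem jcat_junction_end_one {υ : ℕ → Site 2} (hω : ω ∈ wbr n) (hυ : υ ∈ wbr m) : jcat n ω υ (n + 2) 1 = 0 := by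
  have hT := (tailPiece_spec hυ).1
  have hT0 : tailPiece υ 0 = 0 := (mem_saws_iff.1 hT).1
  have h : jcat n ω υ (n + 2) = ω n + tailPiece υ 2 := Zd.concatWalk_apply_add _ _ hT0 2
  rw [h, Pi.add_apply, tailPiece_apply_one_of_le υ le_rfl, (mem_archs.1 (mem_wbr.1 hω).1).2.2, zero_add]

/-- Inside a one-visit seed of length `m`, at seed time `t` even with `0 < t < m`, the concatenation `jcat n ω υ` is OFF the row
(time `n + (2 + t)`). [cite: HammersleyTorrieWhittington1982, §2 (concatenation of surface bridges); BeatonBousquetMelouDeGierDuminilCopinGuttmann2014, §3.1 (arXiv v5 p. 8: surface contacts)] -/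
theorem jcat_seed_apply_one_at {υ : ℕ → Site 2} (hω : ω ∈ wbr n) (hυ : υ ∈ wbr m) (hv : visits m υ = 1) {t : ℕ}
    (ht : t % 2 = 0) (h0t : 0 < t) (htm : t < m) : jcat n ω υ (n + (2 + t)) 1 ≠ 0 := by
  have hT := (tailPiece_spec hυ).1
  have hT0 : tailPiece υ 0 = 0 := (mem_saws_iff.1 hT).1
  have hυ0 : υ 0 = 0 := (mem_saws_iff.1 (hpw_subset (archs_subset (wbr_subset hυ)))).1
  have h : jcat n ω υ (n + (2 + t)) = ω n + tailPiece υ (2 + t) := Zd.concatWalk_apply_add _ _ hT0 (2 + t)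
  rw [h, Pi.add_apply, tailPiece_apply_add_one hυ0, (mem_archs.1 (mem_wbr.1 hω).1).2.2, zero_add]
  exact apply_ne_zero_of_visits_eq_one hυ hv ht h0t htm

/-! ### §2  The free THREE-term superadditivity: junction alone, junction + long seed, junction + short seed after a longer bridge -/

open Classical in
/-- ★ **THE FREE THREE-TERM SUPERADDITIVITY**: for seed lengths `m` and `m + d` (`2 < m`, `0 < d`),
`wbrN (n+m+d) (a+1) + wbrN n a · wbrN (m+d) 1 + wbrN (n+d) a · wbrN m 1 ≤ wbrN (n+m+d+2) (a+2)` — extend a wall bridge of length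
`n+m+d` by the junction (U), or one of length `n` by the junction and a one-visit seed of length `m+d` (H₁), or one of length `n+d` by the
junction and a one-visit seed of length `m` (H₂).  The three images are pairwise DISJOINT: at time `n+m+d` the U-image is on the row while
both H-images sit inside their seeds at a positive even seed time (off the row); at time `n+d+2` the H₂-image is at its junction end
(on the row) while the H₁-image sits inside its seed at seed time `d` (off the row; `d` is even as a difference of wall-bridge lengths).
[cite: HammersleyTorrieWhittington1982, §2 (concatenation of surface bridges)] [cite: JansevanRensburg2000, §3.1.1, Assumptions 3.1(3), eqn (3.1)] -/
theorem wbrN_two_seed_le (hm : 2 < m) {d : ℕ} (hd : 0 < d) (n a : ℕ) :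
    wbrN (n + m + d) (a + 1) + wbrN n a * wbrN (m + d) 1 + wbrN (n + d) a * wbrN m 1 ≤ wbrN (n + m + d + 2) (a + 2) := by
  set triv : ℕ → Site 2 := Zd.straightWalk 2 0 with htriv
  have htm : triv ∈ wbr 0 := straightWalk_zero_mem_wbr
  set U := (wbr (n + m + d)).filter (fun ω => visits (n + m + d) ω = a + 1) with hU
  set H₁ := ((wbr n).filter (fun ω => visits n ω = a)) ×ˢ seeds (m + d) with hH₁
  set H₂ := ((wbr (n + d)).filter (fun ω => visits (n + d) ω = a)) ×ˢ seeds m with hH₂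
  set T := (wbr (n + m + d + 2)).filter (fun ζ => visits (n + m + d + 2) ζ = a + 2) with hT
  set fU : (ℕ → Site 2) → (ℕ → Site 2) := fun ω => jcat (n + m + d) ω triv with hfU
  set f₁ : (ℕ → Site 2) × (ℕ → Site 2) → (ℕ → Site 2) := fun q => jcat n q.1 q.2 with hf₁
  set f₂ : (ℕ → Site 2) × (ℕ → Site 2) → (ℕ → Site 2) := fun q => jcat (n + d) q.1 q.2 with hf₂
  -- images lie in T
  have hUT : U.image fU ⊆ T := by
    intro ζ hζ
    obtain ⟨ω, hω, rfl⟩ := Finset.mem_image.1 hζ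
    obtain ⟨hωw, hωv⟩ := Finset.mem_filter.1 hω
    have sp := jcat_spec hωw htm
    rw [show n + m + d + (2 + 0) = n + m + d + 2 by omega, hωv, visits_zero] at sp
    exact Finset.mem_filter.2 ⟨sp.1, sp.2⟩
  have hH₁T : H₁.image f₁ ⊆ T := by
    intro ζ hζ
    obtain ⟨q, hq, rfl⟩ := Finset.mem_image.1 hζ
    obtain ⟨hq1, hq2⟩ := Finset.mem_product.1 hq
    obtain ⟨hωw, hωv⟩ := Finset.mem_filter.1 hq1
    rw [seeds] at hq2
    obtain ⟨hυw, hυv⟩ := Finset.mem_filter.1 hq2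
    have sp := jcat_spec hωw hυw
    rw [show n + (2 + (m + d)) = n + m + d + 2 by omega, hωv, hυv] at sp
    exact Finset.mem_filter.2 ⟨sp.1, sp.2⟩
  have hH₂T : H₂.image f₂ ⊆ T := by
    intro ζ hζ
    obtain ⟨q, hq, rfl⟩ := Finset.mem_image.1 hζ
    obtain ⟨hq1, hq2⟩ := Finset.mem_product.1 hq
    obtain ⟨hωw, hωv⟩ := Finset.mem_filter.1 hq1
    rw [seeds] at hq2
    obtain ⟨hυw, hυv⟩ := Finset.mem_filter.1 hq2
    have sp := jcat_spec hωw hυw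
    rw [show n + d + (2 + m) = n + m + d + 2 by omega, hωv, hυv] at sp
    exact Finset.mem_filter.2 ⟨sp.1, sp.2⟩
  -- injectivity
  have hUinj : Set.InjOn fU ↑U := by
    intro ω hω ω' hω' h
    have hωs := hpw_subset (archs_subset (wbr_subset (Finset.mem_filter.1 (Finset.mem_coe.1 hω)).1))
    have hω's := hpw_subset (archs_subset (wbr_subset (Finset.mem_filter.1 (Finset.mem_coe.1 hω')).1))
    exact (Zd.concatWalk_injective_pieces (saws_subset _ hωs) (saws_subset _ (tailPiece_spec htm).1)
      (saws_subset _ hω's) (saws_subset _ (tailPiece_spec htm).1) h).1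
  have hHinj : ∀ (n' m' : ℕ) (Hs : Finset ((ℕ → Site 2) × (ℕ → Site 2))),
      Hs ⊆ (wbr n') ×ˢ seeds m' → Set.InjOn (fun q : (ℕ → Site 2) × (ℕ → Site 2) => jcat n' q.1 q.2) ↑Hs := by
    rintro n' m' Hs hHs ⟨ω, υ⟩ hq ⟨ω', υ'⟩ hq' h
    have hq0 := Finset.mem_product.1 (hHs (Finset.mem_coe.1 hq))
    have hq0' := Finset.mem_product.1 (hHs (Finset.mem_coe.1 hq'))
    rw [seeds] at hq0 hq0'
    have hωw := hq0.1
    have hω'w := hq0'.1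
    have hυw : υ ∈ wbr m' := (Finset.mem_filter.1 hq0.2).1
    have hυ'w : υ' ∈ wbr m' := (Finset.mem_filter.1 hq0'.2).1
    have hωs := hpw_subset (archs_subset (wbr_subset hωw))
    have hω's := hpw_subset (archs_subset (wbr_subset hω'w))
    have hυs := hpw_subset (archs_subset (wbr_subset hυw))
    have hυ's := hpw_subset (archs_subset (wbr_subset hυ'w))
    obtain ⟨h1, h2⟩ := Zd.concatWalk_injective_pieces (saws_subset _ hωs) (saws_subset _ (tailPiece_spec hυw).1)
      (saws_subset _ hω's) (saws_subset _ (tailPiece_spec hυ'w).1) h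
    have h3 := tailPiece_injective (mem_saws_iff.1 hυs).1 (mem_saws_iff.1 hυ's).1 h2
    simp only [Prod.mk.injEq]
    exact ⟨h1, h3⟩
  have hH₁inj : Set.InjOn f₁ ↑H₁ :=
    hHinj n (m + d) H₁ (Finset.product_subset_product_left (Finset.filter_subset _ _))
  have hH₂inj : Set.InjOn f₂ ↑H₂ :=
    hHinj (n + d) m H₂ (Finset.product_subset_product_left (Finset.filter_subset _ _))
  -- disjointness U / H₁ and U / H₂: the height at time `n+m+d`
  have hdisj₁ : Disjoint (U.image fU) (H₁.image f₁) := by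
    rw [Finset.disjoint_left]
    intro ζ hζU hζH
    obtain ⟨ω, hω, rfl⟩ := Finset.mem_image.1 hζU
    obtain ⟨q, hq, he⟩ := Finset.mem_image.1 hζH
    obtain ⟨hq1, hq2⟩ := Finset.mem_product.1 hq
    rw [seeds] at hq2
    obtain ⟨hυw, hυv⟩ := Finset.mem_filter.1 hq2
    have hev : (m + d) % 2 = 0 := (mem_archs.1 (mem_wbr.1 hυw).1).2.1
    have h0 : fU ω (n + m + d) 1 = 0 := jcat_apply_self_one (Finset.mem_filter.1 hω).1
    have h1 : f₁ q (n + (2 + (m + d - 2))) 1 ≠ 0 :=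
      jcat_seed_apply_one_at (Finset.mem_filter.1 hq1).1 hυw hυv (by omega) (by omega) (by omega)
    rw [show n + (2 + (m + d - 2)) = n + m + d by omega, he] at h1
    exact h1 h0
  have hdisj₂ : Disjoint (U.image fU) (H₂.image f₂) := by
    rw [Finset.disjoint_left]
    intro ζ hζU hζH
    obtain ⟨ω, hω, rfl⟩ := Finset.mem_image.1 hζU
    obtain ⟨q, hq, he⟩ := Finset.mem_image.1 hζH
    obtain ⟨hq1, hq2⟩ := Finset.mem_product.1 hq
    rw [seeds] at hq2
    obtain ⟨hυw, hυv⟩ := Finset.mem_filter.1 hq2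
    have hev : m % 2 = 0 := (mem_archs.1 (mem_wbr.1 hυw).1).2.1
    have h0 : fU ω (n + m + d) 1 = 0 := jcat_apply_self_one (Finset.mem_filter.1 hω).1
    have h1 : f₂ q (n + d + (2 + (m - 2))) 1 ≠ 0 :=
      jcat_seed_apply_one_at (Finset.mem_filter.1 hq1).1 hυw hυv (by omega) (by omega) (by omega)
    rw [show n + d + (2 + (m - 2)) = n + m + d by omega, he] at h1
    exact h1 h0
  -- disjointness H₁ / H₂: the height at time `n+d+2`
  have hdisj₁₂ : Disjoint (H₁.image f₁) (H₂.image f₂) := by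
    rw [Finset.disjoint_left]
    intro ζ hζ₁ hζ₂
    obtain ⟨q, hq, rfl⟩ := Finset.mem_image.1 hζ₁
    obtain ⟨q', hq', he⟩ := Finset.mem_image.1 hζ₂
    obtain ⟨hq1, hq2⟩ := Finset.mem_product.1 hq
    obtain ⟨hq1', hq2'⟩ := Finset.mem_product.1 hq'
    rw [seeds] at hq2 hq2'
    obtain ⟨hυw, hυv⟩ := Finset.mem_filter.1 hq2
    obtain ⟨hυ'w, -⟩ := Finset.mem_filter.1 hq2'
    have hev₁ : (m + d) % 2 = 0 := (mem_archs.1 (mem_wbr.1 hυw).1).2.1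
    have hev₂ : m % 2 = 0 := (mem_archs.1 (mem_wbr.1 hυ'w).1).2.1
    have h0 : f₂ q' (n + d + 2) 1 = 0 := jcat_junction_end_one (Finset.mem_filter.1 hq1').1 hυ'w
    have h1 : f₁ q (n + (2 + d)) 1 ≠ 0 :=
      jcat_seed_apply_one_at (Finset.mem_filter.1 hq1).1 hυw hυv (by omega) hd (by omega)
    rw [show n + (2 + d) = n + d + 2 by omega, ← he] at h1
    exact h1 h0
  -- count
  have hcU : #(U.image fU) = wbrN (n + m + d) (a + 1) := by rw [Finset.card_image_of_injOn hUinj, wbrN]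
  have hc₁ : #(H₁.image f₁) = wbrN n a * wbrN (m + d) 1 := by
    rw [Finset.card_image_of_injOn hH₁inj, hH₁, Finset.card_product, wbrN, card_seeds]
  have hc₂ : #(H₂.image f₂) = wbrN (n + d) a * wbrN m 1 := by
    rw [Finset.card_image_of_injOn hH₂inj, hH₂, Finset.card_product, wbrN, card_seeds]
  have hdU12 : Disjoint (U.image fU) (H₁.image f₁ ∪ H₂.image f₂) := Finset.disjoint_union_right.2 ⟨hdisj₁, hdisj₂⟩
  calc wbrN (n + m + d) (a + 1) + wbrN n a * wbrN (m + d) 1 + wbrN (n + d) a * wbrN m 1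
      = #(U.image fU ∪ (H₁.image f₁ ∪ H₂.image f₂)) := by
        rw [Finset.card_union_of_disjoint hdU12, Finset.card_union_of_disjoint hdisj₁₂, hcU, hc₁, hc₂]; ring
    _ ≤ #T := Finset.card_le_card (Finset.union_subset hUT (Finset.union_subset hH₁T hH₂T))
    _ = wbrN (n + m + d + 2) (a + 2) := by rw [wbrN]

/-! ### §3  The partition-function form -/

open Classical in
/-- ★ **THE TWO-SEED RECURSION `y·B^w_{n+m+d}(y) + h_{m+d}·y²·B^w_n(y) + h_m·y²·B^w_{n+d}(y) ≤ B^w_{n+m+d+2}(y)`** (`h_k = wbrN k 1`,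
`2 < m`, `0 < d`, `y ≥ 0`).  For `m = 6`, `d = 2`: `y B^w_{n+8} + h₈ y² B^w_n + h₆ y² B^w_{n+2} ≤ B^w_{n+10}` — dips and flat excursions
interleaved FREELY with wall steps (the weighted form of `wbrN_two_seed_le`: a (U)-extension carries one more visit, an (H)-extension
two more). [cite: HammersleyTorrieWhittington1982, §2 (concatenation of surface bridges)] [cite: MadrasSlade1993, §1.2, (1.2.15)] -/
theorem WB_two_seed_rec (hm : 2 < m) {d : ℕ} (hd : 0 < d) (n : ℕ) (hy : 0 ≤ y) :
    y * WB (n + m + d) y + (wbrN (m + d) 1 : ℝ) * y ^ 2 * WB n y + (wbrN m 1 : ℝ) * y ^ 2 * WB (n + d) y ≤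
      WB (n + m + d + 2) y := by
  set triv : ℕ → Site 2 := Zd.straightWalk 2 0 with htriv
  have htm : triv ∈ wbr 0 := straightWalk_zero_mem_wbr
  set fU : (ℕ → Site 2) → (ℕ → Site 2) := fun ω => jcat (n + m + d) ω triv with hfU
  set f₁ : (ℕ → Site 2) × (ℕ → Site 2) → (ℕ → Site 2) := fun q => jcat n q.1 q.2 with hf₁
  set f₂ : (ℕ → Site 2) × (ℕ → Site 2) → (ℕ → Site 2) := fun q => jcat (n + d) q.1 q.2 with hf₂
  set H₁ := (wbr n) ×ˢ seeds (m + d) with hH₁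
  set H₂ := (wbr (n + d)) ×ˢ seeds m with hH₂
  have hUinj : Set.InjOn fU ↑(wbr (n + m + d)) := by
    intro ω hω ω' hω' h
    have hωs := hpw_subset (archs_subset (wbr_subset (Finset.mem_coe.1 hω)))
    have hω's := hpw_subset (archs_subset (wbr_subset (Finset.mem_coe.1 hω')))
    exact (Zd.concatWalk_injective_pieces (saws_subset _ hωs) (saws_subset _ (tailPiece_spec htm).1)
      (saws_subset _ hω's) (saws_subset _ (tailPiece_spec htm).1) h).1
  have hHinj : ∀ (n' m' : ℕ), Set.InjOn (fun q : (ℕ → Site 2) × (ℕ → Site 2) => jcat n' q.1 q.2) ↑((wbr n') ×ˢ seeds m') := by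
    rintro n' m' ⟨ω, υ⟩ hq ⟨ω', υ'⟩ hq' h
    rw [Finset.mem_coe, Finset.mem_product, seeds] at hq hq'
    have hυw : υ ∈ wbr m' := (Finset.mem_filter.1 hq.2).1
    have hυ'w : υ' ∈ wbr m' := (Finset.mem_filter.1 hq'.2).1
    have hωs := hpw_subset (archs_subset (wbr_subset hq.1))
    have hω's := hpw_subset (archs_subset (wbr_subset hq'.1))
    have hυs := hpw_subset (archs_subset (wbr_subset hυw))
    have hυ's := hpw_subset (archs_subset (wbr_subset hυ'w))
    obtain ⟨h1, h2⟩ := Zd.concatWalk_injective_pieces (saws_subset _ hωs) (saws_subset _ (tailPiece_spec hυw).1)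
      (saws_subset _ hω's) (saws_subset _ (tailPiece_spec hυ'w).1) h
    have h3 := tailPiece_injective (mem_saws_iff.1 hυs).1 (mem_saws_iff.1 hυ's).1 h2
    simp only [Prod.mk.injEq]
    exact ⟨h1, h3⟩
  have hH₁inj : Set.InjOn f₁ ↑H₁ := hHinj n (m + d)
  have hH₂inj : Set.InjOn f₂ ↑H₂ := hHinj (n + d) m
  -- disjointness
  have hdisj₁ : Disjoint ((wbr (n + m + d)).image fU) (H₁.image f₁) := by
    rw [Finset.disjoint_left]
    intro ζ hζU hζH
    obtain ⟨ω, hω, rfl⟩ := Finset.mem_image.1 hζU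
    obtain ⟨q, hq, he⟩ := Finset.mem_image.1 hζH
    obtain ⟨hq1, hq2⟩ := Finset.mem_product.1 hq
    rw [seeds] at hq2
    obtain ⟨hυw, hυv⟩ := Finset.mem_filter.1 hq2
    have hev : (m + d) % 2 = 0 := (mem_archs.1 (mem_wbr.1 hυw).1).2.1
    have h0 : fU ω (n + m + d) 1 = 0 := jcat_apply_self_one hω
    have h1 : f₁ q (n + (2 + (m + d - 2))) 1 ≠ 0 := jcat_seed_apply_one_at hq1 hυw hυv (by omega) (by omega) (by omega)
    rw [show n + (2 + (m + d - 2)) = n + m + d by omega, he] at h1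
    exact h1 h0
  have hdisj₂ : Disjoint ((wbr (n + m + d)).image fU) (H₂.image f₂) := by
    rw [Finset.disjoint_left]
    intro ζ hζU hζH
    obtain ⟨ω, hω, rfl⟩ := Finset.mem_image.1 hζU
    obtain ⟨q, hq, he⟩ := Finset.mem_image.1 hζH
    obtain ⟨hq1, hq2⟩ := Finset.mem_product.1 hq
    rw [seeds] at hq2
    obtain ⟨hυw, hυv⟩ := Finset.mem_filter.1 hq2
    have hev : m % 2 = 0 := (mem_archs.1 (mem_wbr.1 hυw).1).2.1
    have h0 : fU ω (n + m + d) 1 = 0 := jcat_apply_self_one hω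
    have h1 : f₂ q (n + d + (2 + (m - 2))) 1 ≠ 0 := jcat_seed_apply_one_at hq1 hυw hυv (by omega) (by omega) (by omega)
    rw [show n + d + (2 + (m - 2)) = n + m + d by omega, he] at h1
    exact h1 h0
  have hdisj₁₂ : Disjoint (H₁.image f₁) (H₂.image f₂) := by
    rw [Finset.disjoint_left]
    intro ζ hζ₁ hζ₂
    obtain ⟨q, hq, rfl⟩ := Finset.mem_image.1 hζ₁
    obtain ⟨q', hq', he⟩ := Finset.mem_image.1 hζ₂
    obtain ⟨hq1, hq2⟩ := Finset.mem_product.1 hq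
    obtain ⟨hq1', hq2'⟩ := Finset.mem_product.1 hq'
    rw [seeds] at hq2 hq2'
    obtain ⟨hυw, hυv⟩ := Finset.mem_filter.1 hq2
    obtain ⟨hυ'w, -⟩ := Finset.mem_filter.1 hq2'
    have hev₁ : (m + d) % 2 = 0 := (mem_archs.1 (mem_wbr.1 hυw).1).2.1
    have hev₂ : m % 2 = 0 := (mem_archs.1 (mem_wbr.1 hυ'w).1).2.1
    have h0 : f₂ q' (n + d + 2) 1 = 0 := jcat_junction_end_one hq1' hυ'w
    have h1 : f₁ q (n + (2 + d)) 1 ≠ 0 := jcat_seed_apply_one_at hq1 hυw hυv (by omega) hd (by omega)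
    rw [show n + (2 + d) = n + d + 2 by omega, ← he] at h1
    exact h1 h0
  have hsub : (wbr (n + m + d)).image fU ∪ (H₁.image f₁ ∪ H₂.image f₂) ⊆ wbr (n + m + d + 2) := by
    refine Finset.union_subset (fun ζ hζ => ?_) (Finset.union_subset (fun ζ hζ => ?_) (fun ζ hζ => ?_))
    · obtain ⟨ω, hω, rfl⟩ := Finset.mem_image.1 hζ
      have sp := (jcat_spec hω htm).1
      rwa [show n + m + d + (2 + 0) = n + m + d + 2 by omega] at sp
    · obtain ⟨q, hq, rfl⟩ := Finset.mem_image.1 hζ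
      obtain ⟨hq1, hq2⟩ := Finset.mem_product.1 hq
      rw [seeds] at hq2
      have sp := (jcat_spec hq1 (Finset.mem_filter.1 hq2).1).1
      rwa [show n + (2 + (m + d)) = n + m + d + 2 by omega] at sp
    · obtain ⟨q, hq, rfl⟩ := Finset.mem_image.1 hζ
      obtain ⟨hq1, hq2⟩ := Finset.mem_product.1 hq
      rw [seeds] at hq2
      have sp := (jcat_spec hq1 (Finset.mem_filter.1 hq2).1).1
      rwa [show n + d + (2 + m) = n + m + d + 2 by omega] at sp
  -- the three sums
  have hsumU : ∑ ζ ∈ (wbr (n + m + d)).image fU, y ^ visits (n + m + d + 2) ζ = y * WB (n + m + d) y := by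
    rw [Finset.sum_image hUinj, WB, Finset.mul_sum]
    refine Finset.sum_congr rfl fun ω hω => ?_
    have sp := (jcat_spec hω htm).2
    rw [show n + m + d + (2 + 0) = n + m + d + 2 by omega, visits_zero, add_zero] at sp
    rw [hfU]; dsimp only
    rw [sp, pow_succ, mul_comm]
  have hsumH : ∀ (n' m' : ℕ) (hN : n' + (2 + m') = n + m + d + 2),
      ∑ ζ ∈ ((wbr n') ×ˢ seeds m').image (fun q : (ℕ → Site 2) × (ℕ → Site 2) => jcat n' q.1 q.2),
        y ^ visits (n + m + d + 2) ζ = (wbrN m' 1 : ℝ) * y ^ 2 * WB n' y := by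
    intro n' m' hN
    rw [Finset.sum_image (hHinj n' m'), Finset.sum_product, WB, Finset.mul_sum]
    refine Finset.sum_congr rfl fun ω hω => ?_
    have hterm : ∀ υ ∈ seeds m', y ^ visits (n + m + d + 2) (jcat n' ω υ) = y ^ 2 * y ^ visits n' ω := by
      intro υ hυ
      rw [seeds] at hυ
      obtain ⟨hυw, hυv⟩ := Finset.mem_filter.1 hυ
      have sp := (jcat_spec hω hυw).2
      rw [hN, hυv] at sp
      rw [sp, show visits n' ω + 1 + 1 = visits n' ω + 2 by ring, pow_add, mul_comm]
    rw [Finset.sum_congr rfl hterm, Finset.sum_const, card_seeds, nsmul_eq_mul]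
    ring
  have hsum₁ := hsumH n (m + d) (by omega)
  have hsum₂ := hsumH (n + d) m (by omega)
  calc y * WB (n + m + d) y + (wbrN (m + d) 1 : ℝ) * y ^ 2 * WB n y + (wbrN m 1 : ℝ) * y ^ 2 * WB (n + d) y
      = ∑ ζ ∈ (wbr (n + m + d)).image fU ∪ (H₁.image f₁ ∪ H₂.image f₂), y ^ visits (n + m + d + 2) ζ := by
        rw [Finset.sum_union (Finset.disjoint_union_right.2 ⟨hdisj₁, hdisj₂⟩), Finset.sum_union hdisj₁₂, hsumU,
          hH₁, hf₁, hsum₁, hH₂, hf₂, hsum₂]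
        ring
    _ ≤ ∑ ζ ∈ wbr (n + m + d + 2), y ^ visits (n + m + d + 2) ζ :=
        Finset.sum_le_sum_of_subset_of_nonneg hsub fun _ _ _ => pow_nonneg hy _
    _ = WB (n + m + d + 2) y := by rw [WB]

/-! ### §4  Subsolutions of the two-seed recursion are lower bounds for `β(y)²` -/

/-- ★ **Every positive subsolution of the two-seed recursion is a lower bound**: if `x > 0` and
`x⁵ ≤ y x⁴ + h₆ y² x + h₈ y²` (`h_k = wbrN k 1`), then `x ≤ β(y)²` (the recursion on even lengths `E_{j+5} ≥ y E_{j+4} + h₆ y² E_{j+1} + h₈ y² E_j`,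
`E_j = B^w_{2j}(y)`, propagates `E_j ≥ c x^j` from the first five values; `E_j ≤ (β²/y)(β²)^j` caps).
[cite: MadrasSlade1993, §1.2, (1.2.15)–(1.2.17)] [cite: HammersleyTorrieWhittington1982, §2] -/
theorem le_sq_wallRate_of_two_seed_subsolution (hy : 0 < y) {x : ℝ} (hx : 0 < x)
    (hsub : x ^ 5 ≤ y * x ^ 4 + (wbrN 6 1 : ℝ) * y ^ 2 * x + (wbrN 8 1 : ℝ) * y ^ 2) : x ≤ wallRate y ^ 2 := by
  set h₆ : ℝ := (wbrN 6 1 : ℝ) with hh6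
  set h₈ : ℝ := (wbrN 8 1 : ℝ) with hh8
  have hh60 : 0 ≤ h₆ := Nat.cast_nonneg _
  have hh80 : 0 ≤ h₈ := Nat.cast_nonneg _
  set E : ℕ → ℝ := fun j => WB (2 * j) y with hE
  have hEpos : ∀ j, 0 < E j := fun j => WB_pos hy j
  have hrec : ∀ j, y * E (j + 4) + h₈ * y ^ 2 * E j + h₆ * y ^ 2 * E (j + 1) ≤ E (j + 5) := by
    intro j
    have := WB_two_seed_rec (m := 6) (by norm_num) (d := 2) (by norm_num) (2 * j) hy.le
    simp only [hE]
    rw [show 2 * (j + 4) = 2 * j + 6 + 2 by ring, show 2 * (j + 5) = 2 * j + 6 + 2 + 2 by ring,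
      show 2 * (j + 1) = 2 * j + 2 by ring]
    exact this
  have hne : (Finset.range 5).Nonempty := ⟨0, by simp⟩
  set c : ℝ := (Finset.range 5).inf' hne (fun j => E j / x ^ j) with hc
  have hcpos : 0 < c := by
    rw [hc, Finset.lt_inf'_iff]
    exact fun j _ => div_pos (hEpos j) (pow_pos hx j)
  have hbase : ∀ j < 5, c * x ^ j ≤ E j := by
    intro j hj
    have hcj : c ≤ E j / x ^ j := Finset.inf'_le _ (Finset.mem_range.2 hj)
    exact (le_div_iff₀ (pow_pos hx j)).1 hcj
  have hall : ∀ j, c * x ^ j ≤ E j := by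
    intro j
    induction j using Nat.strong_induction_on with
    | _ j ih =>
      rcases lt_or_ge j 5 with hj | hj
      · exact hbase j hj
      · obtain ⟨i, rfl⟩ : ∃ i, j = i + 5 := ⟨j - 5, by omega⟩
        have h4 := ih (i + 4) (by omega)
        have h1 := ih (i + 1) (by omega)
        have h0 := ih i (by omega)
        calc c * x ^ (i + 5) = c * x ^ i * x ^ 5 := by ring
          _ ≤ c * x ^ i * (y * x ^ 4 + h₆ * y ^ 2 * x + h₈ * y ^ 2) :=
              mul_le_mul_of_nonneg_left hsub (mul_nonneg hcpos.le (pow_nonneg hx.le _))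
          _ = y * (c * x ^ (i + 4)) + h₈ * y ^ 2 * (c * x ^ i) + h₆ * y ^ 2 * (c * x ^ (i + 1)) := by ring
          _ ≤ y * E (i + 4) + h₈ * y ^ 2 * E i + h₆ * y ^ 2 * E (i + 1) := by
              have a := mul_le_mul_of_nonneg_left h4 hy.le
              have b := mul_le_mul_of_nonneg_left h0 (mul_nonneg hh80 (pow_nonneg hy.le 2))
              have c' := mul_le_mul_of_nonneg_left h1 (mul_nonneg hh60 (pow_nonneg hy.le 2))
              linarith
          _ ≤ E (i + 5) := hrec i
  set B : ℝ := wallRate y ^ 2 with hB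
  have hβ := wallRate_pos y
  have hBpos : 0 < B := pow_pos hβ 2
  have hup : ∀ j, E j ≤ B / y * B ^ j := by
    intro j
    have := WB_le_pow hy (2 * j)
    simp only [hE]
    rw [hB, ← pow_mul]
    exact this
  by_contra hlt
  push Not at hlt
  have hratio : 1 < x / B := (one_lt_div hBpos).2 hlt
  have hbd : ∀ j, (x / B) ^ j ≤ B / (y * c) := by
    intro j
    have h1 : c * x ^ j ≤ B / y * B ^ j := (hall j).trans (hup j)
    have h1' : c * x ^ j * y ≤ B * B ^ j := by
      rw [div_mul_eq_mul_div, le_div_iff₀ hy] at h1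
      exact h1
    rw [div_pow, div_le_div_iff₀ (pow_pos hBpos j) (mul_pos hy hcpos)]
    linarith
  obtain ⟨j, hj⟩ := ((tendsto_pow_atTop_atTop_of_one_lt hratio).eventually_gt_atTop (B / (y * c))).exists
  exact absurd (hbd j) (not_le.2 hj)

/-- ★★ **THE TWO-SEED FREE-ENERGY INEQUALITY `y·β(y)⁸ + h₆·y²·β(y)² + h₈·y² ≤ β(y)¹⁰`** (every `y > 0`): `β(y)²` is not a strict
subsolution (continuity). [cite: JansevanRensburg2000, §3.3.2, Lemma 3.20] [cite: HammersleyTorrieWhittington1982, §2] [cite: MadrasSlade1993, §1.2, (1.2.17)] -/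
theorem two_seed_le_wallRate_pow_ten (hy : 0 < y) :
    y * wallRate y ^ 8 + (wbrN 6 1 : ℝ) * y ^ 2 * wallRate y ^ 2 + (wbrN 8 1 : ℝ) * y ^ 2 ≤ wallRate y ^ 10 := by
  set B : ℝ := wallRate y ^ 2 with hB
  have hBpos : 0 < B := pow_pos (wallRate_pos y) 2
  have e8 : wallRate y ^ 8 = B ^ 4 := by rw [hB, ← pow_mul]
  have e10 : wallRate y ^ 10 = B ^ 5 := by rw [hB, ← pow_mul]
  rw [e8, e10]
  by_contra hlt
  push Not at hlt
  set g : ℝ → ℝ := fun x => y * x ^ 4 + (wbrN 6 1 : ℝ) * y ^ 2 * x + (wbrN 8 1 : ℝ) * y ^ 2 - x ^ 5 with hg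
  have hgB : 0 < g B := by simp only [hg]; linarith
  have hcont : Continuous g := by simp only [hg]; fun_prop
  have hnhds : {x | 0 < g x} ∈ 𝓝 B := hcont.continuousAt.preimage_mem_nhds (Ioi_mem_nhds hgB)
  have hev : ∀ᶠ x in 𝓝[Set.Ioi B] B, 0 < g x := eventually_nhdsWithin_of_eventually_nhds hnhds
  obtain ⟨x, hxg, hxB⟩ := (hev.and self_mem_nhdsWithin).exists
  have hxB' : B < x := hxB
  have hx : 0 < x := hBpos.trans hxB'
  have hsub : x ^ 5 ≤ y * x ^ 4 + (wbrN 6 1 : ℝ) * y ^ 2 * x + (wbrN 8 1 : ℝ) * y ^ 2 := by simp only [hg] at hxg; linarith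
  exact absurd (le_sq_wallRate_of_two_seed_subsolution hy hx hsub) (not_le.2 hxB')

/-- ★★ **`β(y)² ≥ y + h₆·y²/β(y)⁶ + h₈·y²/β(y)⁸`** (every `y > 0`). [cite: JansevanRensburg2000, §3.3.2, Lemma 3.20] [cite: HammersleyTorrieWhittington1982, §2] -/
theorem add_two_seed_div_le_sq_wallRate (hy : 0 < y) :
    y + (wbrN 6 1 : ℝ) * y ^ 2 / wallRate y ^ 6 + (wbrN 8 1 : ℝ) * y ^ 2 / wallRate y ^ 8 ≤ wallRate y ^ 2 := by
  have hβ := wallRate_pos y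
  have h8 : 0 < wallRate y ^ 8 := pow_pos hβ 8
  have key := two_seed_le_wallRate_pow_ten hy
  have e : y + (wbrN 6 1 : ℝ) * y ^ 2 / wallRate y ^ 6 + (wbrN 8 1 : ℝ) * y ^ 2 / wallRate y ^ 8 =
      (y * wallRate y ^ 8 + (wbrN 6 1 : ℝ) * y ^ 2 * wallRate y ^ 2 + (wbrN 8 1 : ℝ) * y ^ 2) / wallRate y ^ 8 := by
    field_simp
  rw [e, div_le_iff₀ h8, show wallRate y ^ 2 * wallRate y ^ 8 = wallRate y ^ 10 by ring]
  exact key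

/-! ### §5  The two seed counts are positive: the dip and the flat excursion -/

namespace Eight

/-- Brick-wall adjacency as a Boolean test on coordinates (as in `HexSAWSurfaceSqrtStrict.Six`). [cite: EntingJensen2009, §7.4.2, Fig. 7.10 (brickwork form of the honeycomb lattice)] -/
def adjE (a b c d : ℤ) : Bool :=
  ((c = a + 1 ∨ a = c + 1) ∧ d = b) ∨ (c = a ∧ ((d = b + 1 ∧ (a + b) % 2 = 0) ∨ (b = d + 1 ∧ (c + d) % 2 = 0)))

/-- The Boolean test is sound. [cite: EntingJensen2009, §7.4.2, Fig. 7.10] -/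
theorem adj_of_adjE {a b c d : ℤ} (h : adjE a b c d = true) : brickWallGraph.Adj (Arm.pt a b) (Arm.pt c d) := by
  rw [brickWallGraph_adj_coord]
  simpa [adjE, Arm.pt_apply_zero, Arm.pt_apply_one] using h

/-- `X`-coordinates of the flat excursion of length eight (frozen value `6` after time 8). [cite: EntingJensen2009, §7.4.2, Fig. 7.10] -/
def fX : ℕ → ℤ
  | 0 => 0 | 1 => 1 | 2 => 1 | 3 => 2 | 4 => 3 | 5 => 4 | 6 => 5 | 7 => 5 | _ => 6

/-- `Y`-coordinates of the flat excursion (frozen value `0` after time 8). [cite: EntingJensen2009, §7.4.2, Fig. 7.10] -/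
def fY : ℕ → ℤ
  | 2 => -1 | 3 => -1 | 4 => -1 | 5 => -1 | 6 => -1 | _ => 0

/-- **The flat excursion of length eight** `(0,0)(1,0)(1,−1)(2,−1)(3,−1)(4,−1)(5,−1)(5,0)(6,0)` (one surface visit, at time 8).
[cite: EntingJensen2009, §7.4.2, Fig. 7.10] -/
def fw (i : ℕ) : Site 2 := Arm.pt (fX (min i 8)) (fY (min i 8))

/-- Coordinate facts of the flat excursion, by `decide`. [cite: EntingJensen2009, §7.4.2, Fig. 7.10] -/
theorem f_facts : (∀ i < 8, adjE (fX i) (fY i) (fX (i + 1)) (fY (i + 1)) = true) ∧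
    (∀ i ≤ 8, ∀ j ≤ 8, fX i = fX j → fY i = fY j → i = j) ∧ (∀ i ≤ 8, fY i ≤ 0) ∧
    (∀ i ≤ 8, fX 0 ≤ fX i ∧ fX i ≤ fX 8) ∧ fX 0 = 0 ∧ fY 0 = 0 ∧ fY 8 = 0 := by decide

/-- Membership components of the flat excursion (`∀`/`∧`/`=` form). [cite: MadrasSlade1993, §1.2, Definition 1.2.4 (bridges); EntingJensen2009, §7.4.2, Fig. 7.10] -/
theorem fw_components : fw 0 = 0 ∧ (∀ i, 8 ≤ i → fw i = fw 8) ∧ IsBW 8 fw ∧ Set.InjOn fw {i | i ≤ 8} ∧ InHP 8 fw ∧ IsArch 8 fw ∧ IsWB 8 fw := by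
  obtain ⟨hadj, hinj, hY, hmono, hX0, hY0, hY8⟩ := f_facts
  refine ⟨?_, fun i hi => by simp only [fw, min_eq_right hi, min_self], fun i hi => ?_, fun i hi j hj hij => ?_, fun i hi => ?_,
    ⟨by norm_num, ?_⟩, fun i hi => ?_⟩
  · rw [site_two_eq_iff]; simp only [fw, Nat.zero_min, Arm.pt_apply_zero, Arm.pt_apply_one, hX0, hY0]; exact ⟨rfl, rfl⟩
  · simp only [fw, min_eq_left hi.le, min_eq_left (Nat.succ_le_of_lt hi)]; exact adj_of_adjE (hadj i hi)
  · simp only [Set.mem_setOf_eq] at hi hj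
    have h0 := congrFun hij 0
    have h1 := congrFun hij 1
    simp only [fw, Arm.pt_apply_zero, Arm.pt_apply_one, min_eq_left hi, min_eq_left hj] at h0 h1
    exact hinj i hi j hj h0 h1
  · simp only [fw, Arm.pt_apply_one, min_eq_left hi]; exact hY i hi
  · simp only [fw, Arm.pt_apply_one, min_self]; exact hY8
  · simp only [fw, Arm.pt_apply_zero, Nat.zero_min, min_self, min_eq_left hi]; exact hmono i hi

/-- One surface visit (kernel evaluation). [cite: BeatonBousquetMelouDeGierDuminilCopinGuttmann2014, §3.1 (arXiv v5 p. 8: "the number of contacts with the surface")] -/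
theorem visits_fw : visits 8 fw = 1 := by decide

end Eight

open Classical in
/-- **At least one one-visit wall bridge of length eight** (`1 ≤ h₈ = wbrN 8 1`): the flat excursion `Eight.fw` (symbolic length to spare
the elaborator the closed `wbr 8`). [cite: JansevanRensburg2000, §3.3.2, Lemma 3.20; EntingJensen2009, §7.4.2, Fig. 7.10] -/
theorem one_le_wbrN_eight_one : 1 ≤ wbrN 8 1 := by
  have key : ∀ m, m = 8 → 1 ≤ #((wbr m).filter fun ω => visits m ω = 1) := by
    intro m hm
    obtain ⟨h0, hfr, hbw, hinj, hH, harch, hwb⟩ := Eight.fw_components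
    have h1 : Eight.fw ∈ wbr m := by
      rw [mem_wbr, mem_archs, mem_hpw, mem_saws_iff]
      subst hm
      exact ⟨⟨⟨⟨h0, hfr, hbw, hinj⟩, hH⟩, harch⟩, hwb⟩
    have h2 : visits m Eight.fw = 1 := by rw [hm]; exact Eight.visits_fw
    exact Finset.card_pos.2 ⟨_, Finset.mem_filter.2 ⟨h1, h2⟩⟩
  exact key 8 rfl

open Classical Six in
/-- **At least one one-visit wall bridge of length six** (`1 ≤ h₆ = wbrN 6 1`): the dip `Six.dw` of `HexSAWSurfaceSqrtStrict`
(the companion module `HexSAWSurfaceSecondOrderSharp` proves `= 1`; here `≥ 1` suffices). [cite: JansevanRensburg2000, §3.3.2, Lemma 3.20; EntingJensen2009, §7.4.2, Fig. 7.10] -/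
theorem one_le_wbrN_six_one : 1 ≤ wbrN 6 1 := by
  have key : ∀ m, m = 6 → 1 ≤ #((wbr m).filter fun ω => visits m ω = 1) := by
    intro m hm
    obtain ⟨h0, hfr, hbw, hinj, hH, harch, hwb⟩ := dw_components
    have h1 : dw ∈ wbr m := by
      rw [mem_wbr, mem_archs, mem_hpw, mem_saws_iff]
      subst hm
      exact ⟨⟨⟨⟨h0, hfr, hbw, hinj⟩, hH⟩, harch⟩, hwb⟩
    have h2 : visits m dw = 1 := by rw [hm]; exact visits_sw_dw.2
    exact Finset.card_pos.2 ⟨_, Finset.mem_filter.2 ⟨h1, h2⟩⟩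
  exact key 6 rfl

/-! ### §6  THE THIRD-ORDER LOWER WINDOW under an upper window -/

/-- ★★ **`β(y)² ≥ y + y²/β(y)⁶ + y²/β(y)⁸`** (every `y > 0`; `h₆, h₈ ≥ 1`). [cite: JansevanRensburg2000, §3.3.2, Lemma 3.20] [cite: HammersleyTorrieWhittington1982, §2] -/
theorem add_div_add_div_le_sq_wallRate (hy : 0 < y) : y + y ^ 2 / wallRate y ^ 6 + y ^ 2 / wallRate y ^ 8 ≤ wallRate y ^ 2 := by
  have hβ := wallRate_pos y
  have key := add_two_seed_div_le_sq_wallRate hy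
  have h6 : (1 : ℝ) ≤ wbrN 6 1 := by exact_mod_cast one_le_wbrN_six_one
  have h8 : (1 : ℝ) ≤ wbrN 8 1 := by exact_mod_cast one_le_wbrN_eight_one
  have a : y ^ 2 / wallRate y ^ 6 ≤ (wbrN 6 1 : ℝ) * y ^ 2 / wallRate y ^ 6 := by
    rw [mul_div_assoc]; exact le_mul_of_one_le_left (by positivity) h6
  have b : y ^ 2 / wallRate y ^ 8 ≤ (wbrN 8 1 : ℝ) * y ^ 2 / wallRate y ^ 8 := by
    rw [mul_div_assoc]; exact le_mul_of_one_le_left (by positivity) h8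
  linarith

/-- ★★★ **THE THIRD-ORDER LOWER WINDOW UNDER AN UPPER WINDOW**: if `β(y)² ≤ y + C/y` (`C ≥ 0`, `y > 0`; the lane has `C = 6` for
`y ≥ 25` and `C = 8749` for `y ≥ 1`), then `β(y)² ≥ y + 1/y + 1/y² − 3C/y³ − 4C/y⁴` — so `liminf_{y→∞} y² (β(y)² − y − 1/y) ≥ 1`: the
renewal prediction for the THIRD coefficient is sharp from below. [cite: JansevanRensburg2000, §3.3.2, Lemma 3.20] [cite: HammersleyTorrieWhittington1982, §2] [cite: BeatonBousquetMelouDeGierDuminilCopinGuttmann2014, §3.1, Proposition 5 (arXiv v5 p. 9)] -/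
theorem third_window_lower (hy : 0 < y) {C : ℝ} (hC : 0 ≤ C) (hup : wallRate y ^ 2 ≤ y + C / y) :
    y + 1 / y + 1 / y ^ 2 - 3 * C / y ^ 3 - 4 * C / y ^ 4 ≤ wallRate y ^ 2 := by
  have hβ := wallRate_pos y
  have key := add_div_add_div_le_sq_wallRate hy
  have hyc : 0 < y ^ 2 + C := by positivity
  -- `β⁶ ≤ (y²+C)³/y³`, `β⁸ ≤ (y²+C)⁴/y⁴`
  have h6 : wallRate y ^ 6 ≤ (y ^ 2 + C) ^ 3 / y ^ 3 := by
    have e : (y ^ 2 + C) ^ 3 / y ^ 3 = (y + C / y) ^ 3 := by field_simp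
    rw [e, show wallRate y ^ 6 = (wallRate y ^ 2) ^ 3 by ring]
    exact pow_le_pow_left₀ (pow_nonneg hβ.le 2) hup 3
  have h8 : wallRate y ^ 8 ≤ (y ^ 2 + C) ^ 4 / y ^ 4 := by
    have e : (y ^ 2 + C) ^ 4 / y ^ 4 = (y + C / y) ^ 4 := by field_simp
    rw [e, show wallRate y ^ 8 = (wallRate y ^ 2) ^ 4 by ring]
    exact pow_le_pow_left₀ (pow_nonneg hβ.le 2) hup 4
  have m6 : y ^ 5 / (y ^ 2 + C) ^ 3 ≤ y ^ 2 / wallRate y ^ 6 := by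
    rw [div_le_div_iff₀ (pow_pos hyc 3) (pow_pos hβ 6)]
    have h6' : wallRate y ^ 6 * y ^ 3 ≤ (y ^ 2 + C) ^ 3 := by rwa [le_div_iff₀ (pow_pos hy 3)] at h6
    nlinarith [pow_pos hy 2, pow_pos hβ 6]
  have m8 : y ^ 6 / (y ^ 2 + C) ^ 4 ≤ y ^ 2 / wallRate y ^ 8 := by
    rw [div_le_div_iff₀ (pow_pos hyc 4) (pow_pos hβ 8)]
    have h8' : wallRate y ^ 8 * y ^ 4 ≤ (y ^ 2 + C) ^ 4 := by rwa [le_div_iff₀ (pow_pos hy 4)] at h8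
    nlinarith [pow_pos hy 2, pow_pos hβ 8]
  -- Bernoulli: `(1 + C/y²)⁻³ ≥ 1 − 3C/y²`, `(1 + C/y²)⁻⁴ ≥ 1 − 4C/y²`
  have b6 : 1 / y - 3 * C / y ^ 3 ≤ y ^ 5 / (y ^ 2 + C) ^ 3 := by
    have e : 1 / y - 3 * C / y ^ 3 = (y ^ 2 - 3 * C) / y ^ 3 := by
      field_simp
    rw [e, div_le_div_iff₀ (pow_pos hy 3) (pow_pos hyc 3)]
    nlinarith [pow_nonneg hC 2, pow_nonneg hC 3, pow_nonneg hy.le 2, mul_nonneg (pow_nonneg hC 2) (pow_nonneg hy.le 2),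
      mul_nonneg hC (pow_nonneg hy.le 4), mul_nonneg (pow_nonneg hC 3) (pow_nonneg hy.le 2)]
  have b8 : 1 / y ^ 2 - 4 * C / y ^ 4 ≤ y ^ 6 / (y ^ 2 + C) ^ 4 := by
    have e : 1 / y ^ 2 - 4 * C / y ^ 4 = (y ^ 2 - 4 * C) / y ^ 4 := by
      field_simp
    rw [e, div_le_div_iff₀ (pow_pos hy 4) (pow_pos hyc 4)]
    -- `(y² − 4C)(y²+C)⁴ ≤ y⁶·y⁴`: with `u = y²`, `(u − 4C)(u+C)⁴ ≤ u⁵`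
    have hu : 0 ≤ y ^ 2 := pow_nonneg hy.le 2
    nlinarith [pow_nonneg hC 2, pow_nonneg hC 3, pow_nonneg hC 4, pow_nonneg hC 5, mul_nonneg hC hu, mul_nonneg (pow_nonneg hC 2) hu,
      mul_nonneg (pow_nonneg hC 2) (pow_nonneg hu 2), mul_nonneg (pow_nonneg hC 3) hu, mul_nonneg hC (pow_nonneg hu 2),
      mul_nonneg hC (pow_nonneg hu 3), mul_nonneg (pow_nonneg hC 2) (pow_nonneg hu 3), mul_nonneg (pow_nonneg hC 3) (pow_nonneg hu 2),
      mul_nonneg (pow_nonneg hC 4) hu]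
  linarith

end Literature.Probability.RandomPlanarGeometry.SAW.HexBW.Wall
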